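import Summits.Ventures.YMGap.RobustBall.DobrushinSupersolution
import Summits.Ventures.YMGap.RobustBall.SlabAxisCriterion
import Summits.Ventures.YMGap.RobustBall.StringTensionCeilingLinear
import HarnessLib

/-!
# Robust ball (Y2), area-law side — the slab two-point function at AXIS rate and the SHARP string-tension floor:
# `σ ≥ log(4/β_W) + log(1 − 3β_W/2)` for `SU(2)`, `d = 4` (floor loss `log 6 → O(β_W)`)

HONEST FRAMING: venture file of the cell `pub-ymgap` (QuantumFields programme), track ROBUST-BALL, seat rb-p2 (g10).
Strong-coupling LATTICE statements for `SU(N)` lattice Yang–Mills on the tori `(ℤ/L)^{n+1}` and for the infinite-volume limit states of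
the torus Wilson states (`infiniteVolumeLimitPoints`); nothing about the continuum, a spectral gap, or Clay.

WHAT IS NEW.  The landed explicit string-tension floor (`StringTensionExplicit.su2_stringTension_ge_log_dim4`: `σ ≥ log(2/(3β_W))`,
i.e. `log(4/β_W) − log 6`) loses the additive constant `log 2(d−1)` because the robust slab door bounds the Durhuus–Fröhlich slab
two-point function by Dobrushin's ROW-SUM profile `c^{dist}`, `c = 2nκ` (`κ = K|β/N|` the one-link coefficient, `= β_W/4` for `SU(2)`),
which counts `(2n)^R` lattice paths between the two vertical legs of the loop.  The legs are AXIS-separated, and along an axis the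
geodesic is unique: with the supersolution form of the covariance estimate (`DobrushinSupersolution`) and the cycle eigenvector
`g(k) = θ^k + θ^{L−k}` as an axis Lyapunov vector (`SlabAxisCriterion`), the slab two-point function between `y + R e_ī` and `y` is
`≤ 16N θ^R` for EVERY `0 < θ ≤ 1` with `κ(2(n−1) + θ + θ⁻¹) ≤ 1` (`slabLaw_zero_entry_cov_le_axis`) — `θ = κ(1 + O(κ))` instead of `2nκ`.
Through the axis-rate criterion this gives the torus area law `|⟨W_{R×T}⟩_{Λ_L,β}| ≤ N(64N³)^T θ^{RT}` (`abs_wilsonExpectation_wilsonLoop_le_axis`),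
hence for every infinite-volume limit state `σ ≥ −log θ` (`wilson_stringTension_ge_axis`); for `SU(2)`, `d = 4`:
★ `σ ≥ log(4/β_W) + log(1 − 3β_W/2)` on `0 < β_W < 4/7` (`su2_stringTension_ge_sharp_dim4`), `σ ≥ log(4/β_W) − 3β_W` on `(0, 1/3]`, and with
the landed ceiling (`su2_stringTension_le_log4_linear_dim4`) the strong-coupling string-tension LAW TWO-SIDED LINEAR:
★★ `|σ(μ) − log(4/β_W)| ≤ 54 β_W` for every infinite-volume limit state at every `0 < β_W ≤ 1/3` (`su2_stringTension_sub_log_abs_le_linear_dim4`).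
The rates are Dobrushin-door artefacts made sharp to first order in `β_W`; they are floors, not a computation of `σ`.

References: Durhuus–Fröhlich CMP 75 (1980); Cao–Nissim–Sheffield arXiv:2509.04688v2 Thm 2.3; H. Föllmer, LNM 1362 (1988) Ch. I (2.8), (2.13).
-/

noncomputable section

open MeasureTheory ProbabilityTheory Filter Topology
open Literature.Probability.LatticeModels hiding glue
open Literature.Probability.LatticeModels.DobrushinMetric
open Literature.MathematicalPhysics.QuantumLattice (fundamentalRep continuous_fundamentalRep fundamentalRep_apply normalisedCharacter)
open Literature.MathematicalPhysics.QuantumFieldTheory hiding ZdEdge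
open Literature.MathematicalPhysics.QuantumFieldTheory.DurhuusFrohlich
open Literature.MathematicalPhysics.QuantumFieldTheory.Balaban1983to89.StrongCouplingDobrushinWindow (OneLinkKRModulus)
open Summit.Ventures.YMGap.RobustBall.DobrushinSupersolution Summit.Ventures.YMGap.RobustBall.SlabAxisProfile

namespace Summit.Ventures.YMGap.RobustBall

variable {n L N : ℕ}

/-! ### The robust slab door with a supersolution -/

section Door

variable [NeZero L] {W : GaugeConfig (n + 1) L (SU N) → ℝ}

/-- **ROBUST SLAB DOOR, SUPERSOLUTION FORM.**  Under the hypotheses of the landed `slab_covariance_le_W` (one-link modulus on the slab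
ball, per-site loads `δ, ℓ, Λ` of the re-weighting with row bound `Λ₀`, row sum `c ≤ 1`), for every rest `r`, single-site observables
`f` at `x` and `g` at `y`, and every vector `v ≥ 0` with `v(y) ≥ 1` and `∑_w C(z,w) v(w) ≤ v(z)` for `z ≠ y` (`C` the door's Dobrushin
matrix `K e^δ(1 + 2√N ℓ)|β| m + √N Λ`): `|Cov_{slabLawW}(f, g)| ≤ 2(2√N)² δg (min 1 v(x) + c^k) δf` for every `k`.
[cite: Follmer1988, Ch. I Theorem (2.13)] -/
theorem slab_covariance_le_W_supersolution (hN : 1 ≤ N) (hL1 : L ≠ 1) (v : Fin (n + 1)) (t : ZMod L)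
    {β R K δ ℓ Λ₀ : ℝ} (hK : 0 ≤ K) (hℓ : 0 ≤ ℓ) (hR : |β| * (2 * (n : ℝ)) ≤ R) (hmod : OneLinkKRModulus N R K)
    (hWm : Measurable W) (hWb : ∃ C, ∀ U, |W U| ≤ C) (r : {e : Edge (n + 1) L // ¬ IsSlab v t e} → SU N)
    (nbrW : TorusSite n L → Finset (TorusSite n L)) (hnotW : ∀ x, x ∉ nbrW x)
    (hdep : ∀ x (η η' : TorusSite n L → SU N), (∀ z ∈ Slab.slabNbr x ∪ nbrW x, η z = η' z) →
      ∃ c : ℝ, ∀ g, siteTiltW v t W r x η g = c + siteTiltW v t W r x η' g)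
    (hδ : ∀ x ω g g', siteTiltW v t W r x ω g - siteTiltW v t W r x ω g' ≤ δ)
    (hℓ' : ∀ x ω g g', |siteTiltW v t W r x ω g - siteTiltW v t W r x ω g'| ≤ ℓ * suFrobDist g g')
    (Λ : TorusSite n L → TorusSite n L → ℝ) (hΛ0 : ∀ x y, 0 ≤ Λ x y)
    (hΛ : ∀ x y (ω η : TorusSite n L → SU N), (∀ z, z ≠ y → ω z = η z) → ∃ c : ℝ, ∀ g,
      |siteTiltW v t W r x ω g - (c + siteTiltW v t W r x η g)| ≤ Λ x y * suFrobDist (ω y) (η y))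
    (hrow : ∀ x, ∑ y ∈ Slab.slabNbr x ∪ nbrW x, Λ x y ≤ Λ₀)
    (hc1 : Real.exp δ * (1 + 2 * Real.sqrt N * ℓ) * (2 * (n : ℝ) * |β| * K) + Real.sqrt N * Λ₀ ≤ 1)
    (x y : TorusSite n L)
    {f g : (TorusSite n L → SU N) → ℝ} (hfm : Measurable f) (hfdep : DependsOn f ({x} : Set (TorusSite n L)))
    {Mf : ℝ} (hMf : ∀ σ, |f σ| ≤ Mf) {δf : ℝ} (hδf : IsLipBound suFrobDist f fun z => if z = x then δf else 0)
    (hgm : Measurable g) (hgdep : DependsOn g ({y} : Set (TorusSite n L))) {Mg : ℝ} (hMg : ∀ σ, |g σ| ≤ Mg)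
    {δg : ℝ} (hδg : IsLipBound suFrobDist g fun z => if z = y then δg else 0)
    {u : TorusSite n L → ℝ} (hu0 : ∀ z, 0 ≤ u z) (hu1 : 1 ≤ u y)
    (hu : ∀ z, z ≠ y → ∑ w ∈ Slab.slabNbr z ∪ nbrW z,
      (K * Real.exp δ * (1 + 2 * Real.sqrt N * ℓ) * |β| * (Slab.slabInfluence z w : ℝ) + Real.sqrt N * Λ z w) * u w ≤ u z)
    (k : ℕ) :
    |cov[f, g; slabLawW v t β W r]| ≤
      2 * (2 * Real.sqrt N) ^ 2 * δg *
        ((min 1 (u x) + (Real.exp δ * (1 + 2 * Real.sqrt N * ℓ) * (2 * (n : ℝ) * |β| * K) + Real.sqrt N * Λ₀) ^ k) * δf) := by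
  classical
  have hγ := isSpecification_slabSpecW (n := n) (L := L) v t β hWm hWb r
  have hKR := isKRContraction_slabSpecW hN hL1 v t hK hℓ hR hmod hWm hWb r nbrW hnotW hdep hδ hℓ' Λ hΛ0 hΛ
  have hc0 : 0 ≤ Real.exp δ * (1 + 2 * Real.sqrt N * ℓ) * (2 * (n : ℝ) * |β| * K) + Real.sqrt N * Λ₀ := by
    have hΛ₀ : 0 ≤ Λ₀ := (Finset.sum_nonneg fun z _ => hΛ0 x z).trans (hrow x)
    positivity
  have key := abs_covariance_le_of_supersolution hγ hKR suFrobDist_nonneg suFrobDist_le (by positivity) hc0 hc1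
    (fun z => slabW_rowsum_le z hK hℓ nbrW Λ (hrow z)) (isGibbsMeasure_slabLawW v t β hWm hWb r) hfm (Δf := {x})
    (by simpa using hfdep) hMf hδf hgm (Δg := {y}) (by simpa using hgdep) hMg hδg hu0
    (fun z hz => by rw [Finset.mem_singleton.1 hz]; exact hu1) (fun z hz => hu z (by simpa using hz)) k
  simpa using key

end Door

/-! ### The Wilson slab laws: axis-separated two-point function at rate `θ` -/

section Wilson

variable [NeZero L]

/-- The total of the zero perturbation vanishes. [folklore] -/
theorem total_zero_apply (U : GaugeConfig (n + 1) L (SU N)) : (0 : Perturbation (n + 1) L N).total U = 0 := by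
  simp [QuasiLocalGaugePerturbation.total]

/-- **THE WILSON SLAB TWO-POINT FUNCTION AT AXIS RATE.**  `SU(N)`, `N ≥ 1`, slice `(ℤ/L)^n` with `L ≥ 3`, 't Hooft coupling `β`,
one-link modulus `OneLinkKRModulus N R K` on the slab ball `R ≥ 2n|β|`, `κ := K|β|`.  For every `0 < θ ≤ 1` with
`κ(2(n−1) + θ + θ⁻¹) ≤ 1` and `2nκ < 1`, every height, every rest, every slice site `y`, horizontal direction `ī`, `2R' ≤ L`, all
entries and `φ, ψ ∈ {Re, Im}`:  `|Cov_{slab}(φ(Q_{y + R' e_ī})_{ij}, ψ(Q_y⁻¹)_{kl})| ≤ 16N · θ^{R'}` — the axis vector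
`u(z) = g(z_ī − y_ī)` of `SlabAxisCriterion` is a supersolution of the Wilson slab door. [cite: Follmer1988, Ch. I Theorem (2.13)] -/
theorem slabLaw_zero_entry_cov_le_axis (hN : 1 ≤ N) (hL : 3 ≤ L) (v : Fin (n + 1)) (t : ZMod L)
    {β R K : ℝ} (hK : 0 ≤ K) (hR : |β| * (2 * (n : ℝ)) ≤ R) (hmod : OneLinkKRModulus N R K)
    {θ : ℝ} (hθ0 : 0 < θ) (hθ1 : θ ≤ 1) (hsup : K * |β| * (2 * ((n : ℝ) - 1) + θ + θ⁻¹) ≤ 1)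
    (hc : 2 * (n : ℝ) * |β| * K < 1)
    (r : {e : Edge (n + 1) L // ¬ IsSlab v t e} → SU N) (y : Site n L) (ī : Fin n) {R' : ℕ} (hRL : 2 * R' ≤ L)
    (i j k l : Fin N) (φ ψ : ℂ → ℝ) (hφ : φ = Complex.re ∨ φ = Complex.im) (hψ : ψ = Complex.re ∨ ψ = Complex.im) :
    |cov[fun Q => φ ((Q (y + Pi.single ī ((R' : ℕ) : ZMod L)) : Matrix (Fin N) (Fin N) ℂ) i j),
        fun Q => ψ ((((Q y)⁻¹ : Matrix.specialUnitaryGroup (Fin N) ℂ) : Matrix (Fin N) (Fin N) ℂ) k l);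
        slabLawW v t β (0 : Perturbation (n + 1) L N).total r]| ≤ 16 * N * θ ^ R' := by
  classical
  set W₀ : GaugeConfig (n + 1) L (SU N) → ℝ := (0 : Perturbation (n + 1) L N).total with hW₀
  have hW0 : ∀ U, W₀ U = 0 := total_zero_apply
  have hWm : Measurable W₀ := (0 : Perturbation (n + 1) L N).measurable_total
  have hWb : ∃ C, ∀ U, |W₀ U| ≤ C := (0 : Perturbation (n + 1) L N).exists_abs_total_le
  have htilt : ∀ x ω g, siteTiltW v t W₀ r x ω g = 0 := fun x ω g => hW0 _
  have hL1 : L ≠ 1 := by omega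
  set x : Site n L := y + Pi.single ī ((R' : ℕ) : ZMod L) with hx
  -- the cycle profile and the axis vector centred at `y`
  obtain ⟨g, hg0, hg2, hg1, hgnb, hgR, -, -⟩ := exists_cycleProfile (L := L) hL hθ0 hθ1
  set u : Site n L → ℝ := fun z => g (z ī - y ī) with hu
  obtain ⟨hfm, hfdep, hf1, hfL⟩ := Slab.entryObs_props (n := n) (L := L) x i j hφ
  obtain ⟨hgm, hgdep, hg1', hgL⟩ := Slab.invEntryObs_props (n := n) (L := L) y k l hψ
  haveI := isProbabilityMeasure_slabLawW (n := n) (L := L) (N := N) v t β hWm hWb r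
  have hc0 : 0 ≤ 2 * (n : ℝ) * |β| * K := by positivity
  -- the supersolution form of the door with all loads zero
  have key : ∀ m : ℕ, |cov[fun Q => φ ((Q x : Matrix (Fin N) (Fin N) ℂ) i j),
      fun Q => ψ ((((Q y)⁻¹ : Matrix.specialUnitaryGroup (Fin N) ℂ) : Matrix (Fin N) (Fin N) ℂ) k l);
      slabLawW v t β W₀ r]| ≤ 2 * (2 * Real.sqrt N) ^ 2 * 1 * ((min 1 (u x) + (2 * (n : ℝ) * |β| * K) ^ m) * 1) := by
    intro m
    have h := slab_covariance_le_W_supersolution (n := n) (L := L) (N := N) (W := W₀) hN hL1 v t (β := β) (R := R)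
      (K := K) (δ := 0) (ℓ := 0) (Λ₀ := 0) hK le_rfl hR hmod hWm hWb r (fun _ => ∅) (fun _ => Finset.notMem_empty _)
      (fun x' η η' _ => ⟨0, fun g' => by rw [htilt, htilt, add_zero]⟩)
      (fun x' ω g' g'' => by rw [htilt, htilt, sub_zero])
      (fun x' ω g' g'' => by rw [htilt, htilt, sub_zero, abs_zero, zero_mul])
      (fun _ _ => 0) (fun _ _ => le_rfl)
      (fun x' y' ω η _ => ⟨0, fun g' => by rw [htilt, htilt, zero_add, sub_zero, abs_zero, zero_mul]⟩)
      (fun x' => by simp) (by simpa using hc.le) x y hfm hfdep hf1 hfL hgm hgdep hg1' hgL (u := u)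
      (fun z => (hg0 _).le) (by simp only [hu, sub_self]; exact hg1) (fun z hz => ?_) m
    · simpa using h
    · -- the supersolution inequality: only the Wilson part, `κ ∑ m(z,w) u(w) ≤ κ(2(n-1) + θ + θ⁻¹) u(z) ≤ u(z)`
      have hrow := sum_slabInfluence_mul_axis_le (n := n) (L := L) z (S := Slab.slabNbr z ∪ ∅) Finset.subset_union_left
        (θ := θ) (fun k' => (hg0 k').le) hgnb ī y
      have hκ : 0 ≤ K * |β| := by positivity
      calc ∑ w ∈ Slab.slabNbr z ∪ ∅, (K * Real.exp 0 * (1 + 2 * Real.sqrt N * 0) * |β| * (Slab.slabInfluence z w : ℝ) +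
              Real.sqrt N * 0) * u w
          = (K * |β|) * ∑ w ∈ Slab.slabNbr z ∪ ∅, (Slab.slabInfluence z w : ℝ) * g (w ī - y ī) := by
            rw [Finset.mul_sum]; refine Finset.sum_congr rfl fun w _ => ?_; simp [hu]; ring
        _ ≤ (K * |β|) * ((2 * ((n : ℝ) - 1) + θ + θ⁻¹) * g (z ī - y ī)) := mul_le_mul_of_nonneg_left hrow hκ
        _ = (K * |β| * (2 * ((n : ℝ) - 1) + θ + θ⁻¹)) * u z := by simp only [hu]; ring
        _ ≤ 1 * u z := mul_le_mul_of_nonneg_right hsup (hg0 _).le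
        _ = u z := one_mul _
  -- `u(x) = g(R') ≤ 2 θ^{R'}` and `k → ∞`
  have hux : u x ≤ 2 * θ ^ R' := by
    simp only [hu, hx, Pi.add_apply, Pi.single_eq_same, add_sub_cancel_left]
    exact hgR R' hRL
  have hN8 : (2 : ℝ) * (2 * Real.sqrt N) ^ 2 = 8 * N := by
    rw [mul_pow, Real.sq_sqrt (Nat.cast_nonneg N)]; ring
  have hlim : Tendsto (fun m : ℕ => 8 * (N : ℝ) * (min 1 (u x) + (2 * (n : ℝ) * |β| * K) ^ m)) atTop
      (𝓝 (8 * (N : ℝ) * (min 1 (u x) + 0))) :=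
    (tendsto_const_nhds.add (tendsto_pow_atTop_nhds_zero_of_lt_one hc0 hc)).const_mul _
  rw [add_zero] at hlim
  have hle : |cov[fun Q => φ ((Q x : Matrix (Fin N) (Fin N) ℂ) i j),
      fun Q => ψ ((((Q y)⁻¹ : Matrix.specialUnitaryGroup (Fin N) ℂ) : Matrix (Fin N) (Fin N) ℂ) k l);
      slabLawW v t β W₀ r]| ≤ 8 * N * min 1 (u x) :=
    ge_of_tendsto' hlim fun m => by have := key m; rw [hN8] at this; linarith
  calc _ ≤ 8 * N * min 1 (u x) := hle
    _ ≤ 8 * N * (2 * θ ^ R') := mul_le_mul_of_nonneg_left ((min_le_right _ _).trans hux) (by positivity)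
    _ = 16 * N * θ ^ R' := by ring

/-- **THE WILSON TORUS AREA LAW AT AXIS RATE** (`SU(N)`, `N ≥ 2`, dimension `n + 1`, tree coupling `β`, 't Hooft `β/N`): from any
one-link modulus `OneLinkKRModulus N R K` on the slab ball `R ≥ 2n|β/N|`, `κ = K|β/N|`, and any `0 < θ ≤ 1` with
`κ(2(n−1) + θ + θ⁻¹) ≤ 1`, `2nκ < 1`: for every torus `L ≥ 3`, base point, plane and `2R', 2T ≤ L`,
`|⟨W_{R'×T}⟩_{Λ_L,β}| ≤ N · (64 N³)^T · e^{−(−log θ) R' T}`. [folklore] -/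
theorem abs_wilsonExpectation_wilsonLoop_le_axis (hN : 2 ≤ N) (hL : 3 ≤ L) (β : ℝ) {R K : ℝ} (hK : 0 ≤ K)
    (hmod : OneLinkKRModulus N R K) (hR : |β / N| * (2 * (n : ℝ)) ≤ R)
    {θ : ℝ} (hθ0 : 0 < θ) (hθ1 : θ ≤ 1) (hsup : K * |β / N| * (2 * ((n : ℝ) - 1) + θ + θ⁻¹) ≤ 1)
    (hc : 2 * (n : ℝ) * |β / N| * K < 1)
    (x : Site (n + 1) L) {i j : Fin (n + 1)} (hij : i ≠ j) {R' T : ℕ} (hRL : 2 * R' ≤ L) (hTL : 2 * T ≤ L) :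
    |wilsonExpectation (fundamentalRep (Fin N)) β (wilsonLoop (fundamentalRep (Fin N)) x i j R' T)| ≤
      N * (64 * (N : ℝ) ^ 3) ^ T * Real.exp (-(-Real.log θ) * ((R' : ℝ) * T)) := by
  have hNr : (N : ℝ) ≠ 0 := by exact_mod_cast (show N ≠ 0 by omega)
  have hN1 : (1 : ℝ) ≤ N := by exact_mod_cast (show 1 ≤ N by omega)
  have hβ : (N : ℝ) * (β / N) = β := by field_simp
  have hC₁ : (0 : ℝ) ≤ 16 * N := by positivity
  have hC₂ : 0 ≤ -Real.log θ := neg_nonneg.2 (Real.log_nonpos hθ0.le hθ1)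
  have hWloc := isSlabLocal_zero (n := n) (N := N) 1 L
  have h := abs_expectation_wilsonLoop_le_axis_rate (n := n) (L := L) hN (β / N) (0 : Perturbation (n + 1) L N) le_rfl
    (fun v => hasVerticalRange_total_of_isSlabLocal hWloc v)
    (fun v t U => total_slabRotate_centre_of_isSlabLocal (by omega) hWloc v t U) (R := R') hC₁ hC₂
    (fun v t r y ī i' j' k l φ ψ hφ hψ => by
      have h1 := slabLaw_zero_entry_cov_le_axis (n := n) (L := L) (N := N) (by omega) hL v t hK hR hmod hθ0 hθ1 hsup hc
        r y ī hRL i' j' k l φ ψ hφ hψ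
      rwa [← Real.rpow_natCast, ← Real.exp_log hθ0, ← Real.exp_mul, show Real.log θ * (R' : ℕ) = -(-Real.log θ) * R' by
        ring] at h1)
    x hij hTL
  rw [hβ, QuasiLocalGaugePerturbation.expectation_zero] at h
  have hmax : max (4 * (16 * (N : ℝ))) 1 = 64 * N := by rw [max_eq_left (by nlinarith)]; ring
  have hpow : (N : ℝ) ^ 2 * (64 * N) = 64 * (N : ℝ) ^ 3 := by ring
  have hexp : -(-Real.log θ / (1 : ℕ)) * ((R' : ℝ) * T) = -(-Real.log θ) * ((R' : ℝ) * T) := by simp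
  rw [hmax, hpow, hexp] at h
  exact h

end Wilson

/-! ### Infinite-volume limit states: the sharp string-tension floor -/

namespace StringTensionAxisFloor

open Literature.MathematicalPhysics.QuantumLattice

/-- **WILSON `ℤ^d` AREA LAW AT AXIS RATE** (`SU(N)`, `N ≥ 2`, dimension `n + 1 ≥ 2`, tree coupling `β`): from any one-link modulus
`OneLinkKRModulus N R K` on the slab ball `R ≥ 2n|β/N|`, `κ = K|β/N|`, and any `0 < θ ≤ 1` with `κ(2(n−1) + θ + θ⁻¹) ≤ 1` and `2nκ < 1`:
EVERY infinite-volume limit state `μ` of the torus Wilson states satisfies the tree's `HasAreaLawWith μ χ_N (64N³) (−log θ)`: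
`|W_μ(R',T)| ≤ (64N³)^{2(R'+T)} θ^{R'T}` for all `R', T ≥ 1`. [folklore] -/
theorem wilson_hasAreaLawWith_axis (hN : 2 ≤ N) (hn : 1 ≤ n) (β : ℝ) {R K : ℝ} (hK : 0 ≤ K)
    (hmod : OneLinkKRModulus N R K) (hR : |β / N| * (2 * (n : ℝ)) ≤ R)
    {θ : ℝ} (hθ0 : 0 < θ) (hθ1 : θ ≤ 1) (hsup : K * |β / N| * (2 * ((n : ℝ) - 1) + θ + θ⁻¹) ≤ 1)
    (hc : 2 * (n : ℝ) * |β / N| * K < 1) {μ : Measure (LGConfig (n + 1) (SUN N))}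
    (hμ : haveI : NeZero (n + 1) := ⟨by omega⟩; μ ∈ infiniteVolumeLimitPoints (fundamentalRep (Fin N)) β) :
    haveI : NeZero (n + 1) := ⟨by omega⟩
    HasAreaLawWith μ (fun g => normalisedCharacter N (fundamentalRep (Fin N) g)) (64 * (N : ℝ) ^ 3) (-Real.log θ) := by
  haveI : NeZero (n + 1) := ⟨by omega⟩
  have hN1 : (1 : ℝ) ≤ N := by exact_mod_cast (show 1 ≤ N by omega)
  have hND : (N : ℝ) ≤ 64 * (N : ℝ) ^ 3 := by
    have h3 : (N : ℝ) ≤ (N : ℝ) ^ 3 := le_self_pow₀ hN1 (by norm_num)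
    nlinarith
  have h01 : (0 : Fin (n + 1)) ≠ 1 := fin_zero_ne_one_of_two_le (by omega)
  have hμ' : μ ∈ perturbedLimitPoints β (0 : PerturbationFamily (n + 1) N) := by rwa [perturbedLimitPoints_zero]
  have hmem : ∀ᶠ L : ℕ in atTop, (0 : PerturbationFamily (n + 1) N) L ∈
      {W : Perturbation (n + 1) (L + 1) N | W = 0 ∧ 3 ≤ L + 1} := by
    filter_upwards [eventually_ge_atTop 2] with L hL
    exact ⟨rfl, by omega⟩
  refine hasAreaLawWith_of_torusBound (β := β) (fun L => {W : Perturbation (n + 1) (L + 1) N | W = 0 ∧ 3 ≤ L + 1})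
    (fun L W hW R' T hR' _ hRL hTL => ?_) 0 hmem hμ'
  obtain ⟨rfl, hL3⟩ := hW
  rw [QuasiLocalGaugePerturbation.expectation_zero]
  have h := abs_wilsonExpectation_wilsonLoop_le_axis (n := n) (L := L + 1) hN hL3 β hK hmod hR hθ0 hθ1 hsup hc
    (0 : Site (n + 1) (L + 1)) h01 hRL hTL
  exact StringTensionExplicit.le_pow_perimeter_of_le hN1 hND (Real.exp_pos _).le hR' h

/-- **WILSON STRING-TENSION FLOOR AT AXIS RATE** (`SU(N)`, `N ≥ 2`, dimension `n + 1 ≥ 2`, tree coupling `β > 0`; data as in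
`wilson_hasAreaLawWith_axis`): EVERY infinite-volume limit state `μ` of the torus Wilson states has a string tension and
`stringTension μ χ_N ≥ −log θ`; its static potential, which exists (`WilsonStringTension.stringTension_le`), obeys
`(−log θ) R' − log((64N³)²) ≤ V(R')` for `R' ≥ 1`. [folklore] -/
theorem wilson_stringTension_ge_axis (hN : 2 ≤ N) (hn : 1 ≤ n) {β : ℝ} (hβ : 0 < β) {R K : ℝ} (hK : 0 ≤ K)
    (hmod : OneLinkKRModulus N R K) (hR : |β / N| * (2 * (n : ℝ)) ≤ R)
    {θ : ℝ} (hθ0 : 0 < θ) (hθ1 : θ ≤ 1) (hsup : K * |β / N| * (2 * ((n : ℝ) - 1) + θ + θ⁻¹) ≤ 1)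
    (hc : 2 * (n : ℝ) * |β / N| * K < 1) {μ : Measure (LGConfig (n + 1) (SUN N))}
    (hμ : haveI : NeZero (n + 1) := ⟨by omega⟩; μ ∈ infiniteVolumeLimitPoints (fundamentalRep (Fin N)) β) :
    haveI : NeZero (n + 1) := ⟨by omega⟩
    (HasStringTension μ (fun g => normalisedCharacter N (fundamentalRep (Fin N) g))
        (stringTension μ (fun g => normalisedCharacter N (fundamentalRep (Fin N) g))) ∧
      -Real.log θ ≤ stringTension μ (fun g => normalisedCharacter N (fundamentalRep (Fin N) g))) ∧
    ∀ (R' : ℕ) (V : ℝ), 1 ≤ R' → HasStaticPotential μ (fun g => normalisedCharacter N (fundamentalRep (Fin N) g)) R' V →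
      -Real.log θ * R' - Real.log ((64 * (N : ℝ) ^ 3) ^ 2) ≤ V := by
  haveI : NeZero (n + 1) := ⟨by omega⟩
  have hρ := TorusAreaLaw.isSpecialUnitaryModel_fundamentalRep N
  obtain ⟨-, hσ, -, -⟩ := WilsonStringTension.stringTension_le (fundamentalRep (Fin N)) hρ hN (by omega) hβ hμ
  have hA := wilson_hasAreaLawWith_axis hN hn β hK hmod hR hθ0 hθ1 hsup hc hμ
  exact ⟨⟨hσ, hA.le_of_hasStringTension hσ⟩,
    fun R' V hR' hV => linear_le_of_hasAreaLawWith_of_hasStaticPotential hA hR' hV⟩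

/-- ★ **`SU(2)`, dimension `d = n + 1 ≥ 2`, Wilson coupling `β_W`** (tree coupling `β_W/2`, quarter modulus `K = 1`, one-link
coefficient `κ = β_W/4`): for every `0 < θ ≤ 1` with `(β_W/4)(2(n−1) + θ + θ⁻¹) ≤ 1` and `nβ_W < 2`, EVERY infinite-volume limit state
`μ` of the torus Wilson states has `σ(μ) ≥ −log θ`.  (The landed floor is `θ = nβ_W/2`; here `θ = (β_W/4)(1 + O(β_W))` is admissible.)
[folklore] -/
theorem su2_stringTension_ge_axis (hn : 1 ≤ n) {βW : ℝ} (hβ : 0 < βW) (hβ1 : (n : ℝ) * βW < 2)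
    {θ : ℝ} (hθ0 : 0 < θ) (hθ1 : θ ≤ 1) (hsup : βW / 4 * (2 * ((n : ℝ) - 1) + θ + θ⁻¹) ≤ 1)
    {μ : Measure (LGConfig (n + 1) (SUN 2))}
    (hμ : haveI : NeZero (n + 1) := ⟨by omega⟩; μ ∈ infiniteVolumeLimitPoints (fundamentalRep (Fin 2)) (βW / 2)) :
    haveI : NeZero (n + 1) := ⟨by omega⟩
    HasStringTension μ (fun g => normalisedCharacter 2 (fundamentalRep (Fin 2) g))
        (stringTension μ (fun g => normalisedCharacter 2 (fundamentalRep (Fin 2) g))) ∧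
      -Real.log θ ≤ stringTension μ (fun g => normalisedCharacter 2 (fundamentalRep (Fin 2) g)) := by
  haveI : NeZero (n + 1) := ⟨by omega⟩
  have hnpos : (0 : ℝ) < n := by exact_mod_cast (show 0 < n by omega)
  have habs : |βW / 2 / (2 : ℕ)| = βW / 4 := by rw [abs_of_nonneg (by positivity)]; push_cast; ring
  have hmod := SlabAreaLawDimensions.su2_oneLinkKRModulus_of_le_one (R := (n : ℝ) * βW / 2) (by linarith)
  exact (wilson_stringTension_ge_axis (n := n) (N := 2) le_rfl hn (by positivity) zero_le_one hmod
    (by rw [habs]; linarith) hθ0 hθ1 (by rw [habs, one_mul]; exact hsup) (by rw [habs]; linarith) hμ).1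

/-- ★★ **`SU(2)`, `d = 4`: THE SHARP STRONG-COUPLING FLOOR `σ(μ) ≥ log(4/β_W) + log(1 − 3β_W/2) = log(4/β_W − 6)`** for every
infinite-volume limit state at every `0 < β_W < 4/7` — the admissible `θ = (β_W/4)/(1 − 3β_W/2)` (`κ/θ = 1 − 6κ` absorbs the four
transverse neighbours `4κ` and `κθ ≤ 2κ`).  At `β_W = 1/8`: `σ ≥ log 26 ≥ 3.25` (landed: `log(16/3) ≈ 1.67`; leading order `log 32 ≈ 3.47`).
[folklore] -/
theorem su2_stringTension_ge_sharp_dim4 {βW : ℝ} (hβ : 0 < βW) (hβ1 : βW < 4 / 7) {μ : Measure (LGConfig 4 (SUN 2))}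
    (hμ : μ ∈ infiniteVolumeLimitPoints (fundamentalRep (Fin 2)) (βW / 2)) :
    HasStringTension μ (fun g => normalisedCharacter 2 (fundamentalRep (Fin 2) g))
        (stringTension μ (fun g => normalisedCharacter 2 (fundamentalRep (Fin 2) g))) ∧
      Real.log (4 / βW) + Real.log (1 - 3 * βW / 2) ≤
        stringTension μ (fun g => normalisedCharacter 2 (fundamentalRep (Fin 2) g)) := by
  set θ : ℝ := βW / 4 / (1 - 3 * βW / 2) with hθ
  have hden : 0 < 1 - 3 * βW / 2 := by linarith
  have hθ0 : 0 < θ := div_pos (by positivity) hden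
  have hθ1 : θ ≤ 1 := by rw [hθ, div_le_one hden]; linarith
  have hθle2 : θ ≤ 2 := by linarith
  have hinv : θ⁻¹ = (1 - 3 * βW / 2) / (βW / 4) := by rw [hθ, inv_div]
  have hsup : βW / 4 * (2 * (((3 : ℕ) : ℝ) - 1) + θ + θ⁻¹) ≤ 1 := by
    push_cast
    have h1 : βW / 4 * θ⁻¹ = 1 - 3 * βW / 2 := by rw [hinv]; field_simp
    have h2 : βW / 4 * θ ≤ βW / 4 * 2 := mul_le_mul_of_nonneg_left hθle2 (by positivity)
    nlinarith
  obtain ⟨hσ, h⟩ := su2_stringTension_ge_axis (n := 3) (by norm_num) hβ (by push_cast; linarith) hθ0 hθ1 hsup hμ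
  refine ⟨hσ, ?_⟩
  have hlog : -Real.log θ = Real.log (4 / βW) + Real.log (1 - 3 * βW / 2) := by
    rw [hθ, Real.log_div (by positivity) hden.ne', Real.log_div (by norm_num) hβ.ne', Real.log_div hβ.ne' (by norm_num)]
    ring
  rw [hlog] at h
  exact h

/-- ★★ **`SU(2)`, `d = 3`: `σ(μ) ≥ log(4/β_W) + log(1 − β_W) = log(4/β_W − 4)`** for every infinite-volume limit state at every
`0 < β_W ≤ 4/5` (admissible `θ = (β_W/4)/(1 − β_W)`; the landed floor is `log(1/β_W)`, the leading order `log(4/β_W)`). [folklore] -/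
theorem su2_stringTension_ge_sharp_dim3 {βW : ℝ} (hβ : 0 < βW) (hβ1 : βW ≤ 4 / 5) {μ : Measure (LGConfig 3 (SUN 2))}
    (hμ : μ ∈ infiniteVolumeLimitPoints (fundamentalRep (Fin 2)) (βW / 2)) :
    HasStringTension μ (fun g => normalisedCharacter 2 (fundamentalRep (Fin 2) g))
        (stringTension μ (fun g => normalisedCharacter 2 (fundamentalRep (Fin 2) g))) ∧
      Real.log (4 / βW) + Real.log (1 - βW) ≤
        stringTension μ (fun g => normalisedCharacter 2 (fundamentalRep (Fin 2) g)) := by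
  set θ : ℝ := βW / 4 / (1 - βW) with hθ
  have hden : 0 < 1 - βW := by linarith
  have hθ0 : 0 < θ := div_pos (by positivity) hden
  have hθ1 : θ ≤ 1 := by rw [hθ, div_le_one hden]; linarith
  have hθle2 : θ ≤ 2 := by linarith
  have hinv : θ⁻¹ = (1 - βW) / (βW / 4) := by rw [hθ, inv_div]
  have hsup : βW / 4 * (2 * (((2 : ℕ) : ℝ) - 1) + θ + θ⁻¹) ≤ 1 := by
    push_cast
    have h1 : βW / 4 * θ⁻¹ = 1 - βW := by rw [hinv]; field_simp
    have h2 : βW / 4 * θ ≤ βW / 4 * 2 := mul_le_mul_of_nonneg_left hθle2 (by positivity)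
    nlinarith
  obtain ⟨hσ, h⟩ := su2_stringTension_ge_axis (n := 2) (by norm_num) hβ (by push_cast; linarith) hθ0 hθ1 hsup hμ
  refine ⟨hσ, ?_⟩
  have hlog : -Real.log θ = Real.log (4 / βW) + Real.log (1 - βW) := by
    rw [hθ, Real.log_div (by positivity) hden.ne', Real.log_div hβ.ne' (by norm_num), Real.log_div (by norm_num) hβ.ne']
    ring
  rw [hlog] at h
  exact h

/-- ★★ **`SU(2)`, `d = 4`, linear form: `σ(μ) ≥ log(4/β_W) − 3β_W` on `0 < β_W ≤ 1/3`** (`log(1 − x) ≥ −2x` for `0 ≤ x ≤ 1/2`). [folklore] -/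
theorem su2_stringTension_ge_log4_sub_linear_dim4 {βW : ℝ} (hβ : 0 < βW) (hβ1 : βW ≤ 1 / 3)
    {μ : Measure (LGConfig 4 (SUN 2))} (hμ : μ ∈ infiniteVolumeLimitPoints (fundamentalRep (Fin 2)) (βW / 2)) :
    Real.log (4 / βW) - 3 * βW ≤ stringTension μ (fun g => normalisedCharacter 2 (fundamentalRep (Fin 2) g)) := by
  obtain ⟨-, h⟩ := su2_stringTension_ge_sharp_dim4 hβ (by linarith) hμ
  -- `log(1 - x) ≥ -2x` on `[0, 1/2]` from `1 - x ≥ e^{-2x}`: `e^{-2x} ≤ 1/(1 + 2x) ≤ 1 - x`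
  set x : ℝ := 3 * βW / 2 with hx
  have hx0 : 0 ≤ x := by positivity
  have hx1 : x ≤ 1 / 2 := by rw [hx]; linarith
  have hlog : -2 * x ≤ Real.log (1 - x) := by
    rw [Real.le_log_iff_exp_le (by linarith)]
    have h1 : Real.exp (-2 * x) ≤ 1 / (1 + 2 * x) := by
      rw [le_div_iff₀ (by linarith), show -2 * x = -(2 * x) by ring, Real.exp_neg]
      have := Real.add_one_le_exp (2 * x)
      have hpos := Real.exp_pos (2 * x)
      calc (Real.exp (2 * x))⁻¹ * (1 + 2 * x) ≤ (Real.exp (2 * x))⁻¹ * Real.exp (2 * x) :=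
            mul_le_mul_of_nonneg_left (by linarith) (inv_nonneg.2 hpos.le)
        _ = 1 := inv_mul_cancel₀ hpos.ne'
    have h2 : 1 / (1 + 2 * x) ≤ 1 - x := by
      rw [div_le_iff₀ (by linarith)]; nlinarith
    exact h1.trans h2
  rw [hx] at hlog
  linarith

/-- ★★★ **THE STRONG-COUPLING STRING-TENSION LAW, TWO-SIDED LINEAR** (`SU(2)`, `d = 4`): for EVERY infinite-volume limit state `μ` of
the torus Wilson states at every `0 < β_W ≤ 1/3`,  `|σ(μ) − log(4/β_W)| ≤ 54 β_W`  — floor `log(4/β_W) − 3β_W` (this file), ceiling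
`log(4/β_W) + 54β_W` (landed `su2_stringTension_le_log4_linear_dim4`).  The landed two-sided law had the `β_W`-independent floor loss `log 6`.
[folklore] -/
theorem su2_stringTension_sub_log_abs_le_linear_dim4 {βW : ℝ} (hβ : 0 < βW) (hβ1 : βW ≤ 1 / 3)
    {μ : Measure (LGConfig 4 (SUN 2))} (hμ : μ ∈ infiniteVolumeLimitPoints (fundamentalRep (Fin 2)) (βW / 2)) :
    |stringTension μ (fun g => normalisedCharacter 2 (fundamentalRep (Fin 2) g)) - Real.log (4 / βW)| ≤ 54 * βW := by
  have hlow := su2_stringTension_ge_log4_sub_linear_dim4 hβ hβ1 hμ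
  have hup := StringTensionExplicit.su2_stringTension_le_log4_linear_dim4 hβ hμ
  rw [abs_le]; constructor <;> linarith

end StringTensionAxisFloor

end Summit.Ventures.YMGap.RobustBall

end
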